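import Summits.Ventures.PercRepro.RLSRuleOneLineCount
import Summits.Ventures.PercRepro.RLSRuleLineFreeArith

/-!
# PercRepro — `R₃⁺` at `t = 0` on EVERY plane with exactly one `3`-point line, every `p ≥ 8` (night-3, gen 3)

The second infinite family of the `t = 0, P₂` half of the lane (`proofs/N3-R3PLUS-plan.md` §1), with the loss case
(L3): on a plane `G` with exactly one `3`-point line `ℓ` (`OneLine`), every rank-`3` subset `B′ ⊆ G` pays `Φ(p, 3)`
by itself —

* `ℓ ⊄ B′`: no loss, the share is at least the triple share `1 / C(3 + x, 3)` in every witness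
  (`wPlus_ge_of_oneLine` with `ρ₃(B′) = C(b, 3)` and `choose_three_mul_choose_three_ge`); total `Φ(p, 3)`;
* `ℓ ⊆ B′`, `|B′| = 4`: `3 / C(4 + x, 3)` on the good witnesses, total `≥ 3 (z₁ − lost₄) ≥ Φ` (`sum_good_four_ge`);
* `ℓ ⊆ B′`, `|B′| = 5`: `9 / C(5 + x, 3) ≥ 8 / C(5 + x, 3)` on the good witnesses, total `≥ 8 (z₂ − lost₅) ≥ Φ`
  (`sum_good_five_ge`);
* `ℓ ⊆ B′`, `|B′| ≥ 6`: share `1` on the good witnesses, total `≥ l2aSum n ≥ Φ` (`card_not_subset_ge`);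
and the demand is `#U_G ≤ 2^g − 2 − g − C(g, 2)` = the number of rank-`3` subsets (`card_UqG_le_of_oneLine`).

* **`perFlat_oneLine`** — `Φ(p, 3) · #U_G ≤ Σ_{S ∈ Yq} w⁺(G, S)` for every `OneLine` plane `G` of type `0`
  (`ρ(E ∖ G) ≥ p`) and every `p ≥ 8`.
Imports `RLSRuleOneLineCount`, `RLSRuleLineFreeArith`.  Axioms: standard.
-/

open scoped Matroid

namespace PercRepro

namespace NightThree

open Finset ThmH PerFlat

variable {α : Type*} [DecidableEq α] {M : Matroid α} [M.Finite]

/-- The demand of a `OneLine` plane: at most `Σ_{b ≥ 3} C(g, b) − 1` (every subset with `≥ 3` points except `ℓ`). -/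
theorem card_UqG_le_of_oneLine {G ℓ : Finset α} (h : OneLine M G ℓ) (p : ℕ) :
    ((UqG M p 3 G).card : ℚ) ≤ demandCount G.card 0 - 1 := by
  classical
  obtain ⟨hℓG, hℓc, hℓr, _⟩ := h
  have hsub : UqG M p 3 G ⊆ (G.powerset.filter (fun B => 3 ≤ B.card)).erase ℓ := by
    intro B hB
    unfold UqG at hB
    rw [Finset.mem_filter, mem_Uq] at hB
    obtain ⟨⟨_, hB3, _⟩, hBG⟩ := hB
    have hB3' : M.eRk (B : Set α) = 3 := by exact_mod_cast hB3
    rw [Finset.mem_erase, Finset.mem_filter, Finset.mem_powerset]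
    refine ⟨?_, hBG, three_le_card_of_eRk_eq_three hB3'⟩
    rintro rfl
    rw [hℓr] at hB3'
    exact absurd hB3' (by norm_num)
  have hcard : ((G.powerset.filter (fun B => 3 ≤ B.card)).card : ℚ) = demandCount G.card 0 := by
    unfold demandCount
    rw [Finset.card_filter, Nat.cast_sum,
      Finset.sum_powerset_apply_card (fun b => ((if 3 ≤ b then 1 else 0 : ℕ) : ℚ))]
    apply Finset.sum_congr rfl
    intro b hb
    rw [Finset.mem_range] at hb
    rw [nsmul_eq_mul]
    congr 1
    by_cases h3 : 3 ≤ b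
    · rw [if_pos h3, if_pos ⟨h3, by omega⟩]; rfl
    · rw [if_neg h3, if_neg (fun h => h3 h.1)]; rfl
  have hmem : ℓ ∈ G.powerset.filter (fun B => 3 ≤ B.card) := by
    rw [Finset.mem_filter, Finset.mem_powerset]
    exact ⟨hℓG, by omega⟩
  have h1 := Finset.card_le_card hsub
  rw [Finset.card_erase_of_mem hmem] at h1
  have hpos : 1 ≤ (G.powerset.filter (fun B => 3 ≤ B.card)).card := Finset.card_pos.2 ⟨ℓ, hmem⟩
  have h2 : ((UqG M p 3 G).card : ℚ) ≤ ((G.powerset.filter (fun B => 3 ≤ B.card)).card : ℚ) - 1 := by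
    have : (UqG M p 3 G).card + 1 ≤ (G.powerset.filter (fun B => 3 ≤ B.card)).card := by omega
    have := (Nat.cast_le (α := ℚ)).2 this
    push_cast at this
    linarith
  rw [hcard] at h2
  exact h2

open scoped Classical in
/-- The share lower bound used for a rank-`3` subset `B′` of a `OneLine` plane in the witness `X`. -/
noncomputable def oneLineShare (M : Matroid α) (ℓ K B X : Finset α) : ℚ :=
  if ℓ ⊆ B then
    (if GoodWitness M ℓ K X then
      (if B.card = 4 then 3 / (((4 + X.card).choose 3 : ℕ) : ℚ)
        else if B.card = 5 then 8 / (((5 + X.card).choose 3 : ℕ) : ℚ) else 1)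
      else 0)
  else 1 / (((3 + X.card).choose 3 : ℕ) : ℚ)

open scoped Classical in
/-- The bound is a valid share bound. -/
theorem oneLineShare_le_wPlus {G ℓ K B X : Finset α} (hG : G ∈ flatsQ M 3) (h : OneLine M G ℓ)
    (hB : B ⊆ G) (hBc : 3 ≤ B.card) (hBℓ : B ≠ ℓ) (hX : M.Indep (X : Set α)) (hXG : Disjoint X G)
    (hXK : X ⊆ K) : oneLineShare M ℓ K B X ≤ wPlus M G (B ∪ X) := by
  unfold oneLineShare
  by_cases hℓB : ℓ ⊆ B
  · have hB4 : 4 ≤ B.card := by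
      by_contra hc
      push Not at hc
      exact hBℓ (Finset.eq_of_subset_of_card_le hℓB (by rw [h.2.1]; omega)).symm
    rw [if_pos hℓB]
    by_cases hgood : GoodWitness M ℓ K X
    · rw [if_pos hgood]
      have hw := wPlus_ge_of_oneLine hG h hB hX hXG hXK (Or.inr hgood)
      rw [if_pos hℓB] at hw
      by_cases h4 : B.card = 4
      · rw [if_pos h4]
        rw [if_pos (show B.card ≤ 5 by omega), h4] at hw
        refine le_trans (le_of_eq ?_) hw
        norm_num [Nat.choose]
      · rw [if_neg h4]
        by_cases h5 : B.card = 5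
        · rw [if_pos h5]
          rw [if_pos (show B.card ≤ 5 by omega), h5] at hw
          refine le_trans ?_ hw
          have hpos : (0 : ℚ) < (((5 + X.card).choose 3 : ℕ) : ℚ) := by
            exact_mod_cast Nat.choose_pos (by omega : 3 ≤ 5 + X.card)
          rw [div_le_div_iff_of_pos_right hpos]
          norm_num [Nat.choose]
        · rw [if_neg h5]
          rw [if_neg (show ¬ B.card ≤ 5 by omega)] at hw
          exact hw
    · rw [if_neg hgood]
      exact wPlus_nonneg M G (B ∪ X)
  · rw [if_neg hℓB]
    have hw := wPlus_ge_of_oneLine hG h hB hX hXG hXK (Or.inl hℓB)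
    rw [if_neg hℓB] at hw
    refine le_trans ?_ hw
    rcases le_or_gt B.card 5 with h5 | h6
    · rw [if_pos h5]
      obtain ⟨m, hm⟩ : ∃ m, B.card = m + 3 := ⟨B.card - 3, by omega⟩
      rw [hm, Nat.sub_zero, div_le_div_iff₀ (by exact_mod_cast Nat.choose_pos (by omega : 3 ≤ 3 + X.card))
        (by exact_mod_cast Nat.choose_pos (by omega : 3 ≤ m + 3 + X.card)), one_mul, add_comm 3 X.card]
      exact choose_three_mul_choose_three_ge m X.card
    · rw [if_neg (show ¬ B.card ≤ 5 by omega)]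
      rw [div_le_one (by exact_mod_cast Nat.choose_pos (by omega : 3 ≤ 3 + X.card))]
      exact_mod_cast Nat.choose_pos (by omega : 3 ≤ 3 + X.card)

open scoped Classical in
/-- Every rank-`3` subset of a `OneLine` plane pays `Φ(p, 3)` over the witness family. -/
theorem sum_oneLineShare_ge {G ℓ K B : Finset α} (hG : G ∈ flatsQ M 3) (h : OneLine M G ℓ)
    (hKsub : K ⊆ gr M \ G) (hKind : M.Indep (K : Set α)) {n : ℕ} (hn : 4 ≤ n)
    (hKcard : K.card = n + 4) :
    phiK (n + 4) 3 ≤ ∑ X ∈ witnessFamily K n, oneLineShare M ℓ K B X := by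
  by_cases hℓB : ℓ ⊆ B
  · -- the good witnesses: `GoodWitness` contains `¬ C ⊆ X` for the unique coplanar triple `C`
    -- (or for any `3`-subset of `K` when there is none)
    have hℓE : ℓ ⊆ gr M := h.1.trans (mem_flatsQ.1 hG).1
    have hKG : Disjoint K G := by
      rw [Finset.disjoint_left]
      intro x hxK hxG
      have := hKsub hxK
      rw [Finset.mem_sdiff] at this
      exact this.2 hxG
    have hoff : ∀ y ∈ K, y ∉ M.closure (ℓ : Set α) := by
      intro y hyK hy
      have hGflat : M.IsFlat (G : Set α) := (mem_flatsQ.1 hG).2.1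
      have : y ∈ (G : Set α) := by
        have := M.closure_subset_closure (Finset.coe_subset.2 h.1) hy
        rwa [hGflat.closure] at this
      exact Finset.disjoint_left.1 hKG hyK (Finset.mem_coe.1 this)
    have hle1 := card_coplanar_triples_le_one h.2.2.1 hℓE hKind hoff
    obtain ⟨C, hCK, hCc, hgoodC⟩ : ∃ C ⊆ K, C.card = 3 ∧ ∀ X, ¬ C ⊆ X → GoodWitness M ℓ K X := by
      rcases Finset.eq_empty_or_nonempty (coplanarTriples M ℓ K) with hemp | ⟨C, hC⟩
      · obtain ⟨C, hCK, hCc⟩ := Finset.exists_subset_card_eq (show 3 ≤ K.card by omega)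
        refine ⟨C, hCK, hCc, fun X _ C' hC' => ?_⟩
        unfold coplanarTriples at hC' hemp
        rw [hemp] at hC'
        exact absurd hC' (Finset.notMem_empty C')
      · have hCK : C ⊆ K := by
          unfold coplanarTriples at hC
          exact (Finset.mem_powersetCard.1 (Finset.mem_filter.1 hC).1).1
        have hCc : C.card = 3 := by
          unfold coplanarTriples at hC
          exact (Finset.mem_powersetCard.1 (Finset.mem_filter.1 hC).1).2
        refine ⟨C, hCK, hCc, fun X hX C' hC' => ?_⟩
        have : C' = C := by
          unfold coplanarTriples at hC hC'
          exact Finset.card_le_one.1 hle1 C' hC' C hC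
        rw [this]
        exact hX
    -- the value of the share on the witnesses not containing `C`
    have hval : ∀ X ∈ (witnessFamily K n).filter (fun X => ¬ C ⊆ X),
        (if B.card = 4 then 3 / (((4 + X.card).choose 3 : ℕ) : ℚ)
          else if B.card = 5 then 8 / (((5 + X.card).choose 3 : ℕ) : ℚ) else 1) ≤ oneLineShare M ℓ K B X := by
      intro X hX
      rw [Finset.mem_filter] at hX
      unfold oneLineShare
      rw [if_pos hℓB, if_pos (hgoodC X hX.2)]
    have hnonneg : ∀ X ∈ witnessFamily K n, 0 ≤ oneLineShare M ℓ K B X := by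
      intro X _
      unfold oneLineShare
      split_ifs <;> positivity
    calc phiK (n + 4) 3
        ≤ ∑ X ∈ (witnessFamily K n).filter (fun X => ¬ C ⊆ X),
            (if B.card = 4 then 3 / (((4 + X.card).choose 3 : ℕ) : ℚ)
              else if B.card = 5 then 8 / (((5 + X.card).choose 3 : ℕ) : ℚ) else 1) := by
          by_cases h4 : B.card = 4
          · simp only [h4, if_true]
            exact sum_good_four_ge hn hKcard hCK hCc
          · by_cases h5 : B.card = 5
            · simp only [h5, if_true, if_false, show (5 : ℕ) ≠ 4 by norm_num]
              exact sum_good_five_ge hn hKcard hCK hCc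
            · simp only [h4, h5, if_false, Finset.sum_const, nsmul_eq_mul, mul_one]
              exact card_not_subset_ge hn hKcard hCK hCc
      _ ≤ ∑ X ∈ (witnessFamily K n).filter (fun X => ¬ C ⊆ X), oneLineShare M ℓ K B X :=
          Finset.sum_le_sum hval
      _ ≤ ∑ X ∈ witnessFamily K n, oneLineShare M ℓ K B X :=
          Finset.sum_le_sum_of_subset_of_nonneg (Finset.filter_subset _ _) (fun X hX _ => hnonneg X hX)
  · -- no loss: the triple share, summing to `Φ`
    have hval : ∀ X ∈ witnessFamily K n, oneLineShare M ℓ K B X = 1 / (((3 + X.card).choose 3 : ℕ) : ℚ) := by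
      intro X _
      unfold oneLineShare
      rw [if_neg hℓB]
    rw [Finset.sum_congr rfl hval, sum_witness_eq_phiK hKcard]

open scoped Classical in
/-- **`R₃⁺` at `t = 0` on every plane with exactly one `3`-point line**, every `p ≥ 8`: for a `OneLine` plane `G`
with `ρ(E ∖ G) ≥ p`, `Φ(p, 3) · #U_G ≤ Σ_{S ∈ Yq} w⁺(G, S)`. -/
theorem perFlat_oneLine {G ℓ : Finset α} (hG : G ∈ flatsQ M 3) (h : OneLine M G ℓ) {n : ℕ} (hn : 4 ≤ n)
    (hK : ((n + 4 : ℕ) : ℕ∞) ≤ M.eRk ((gr M \ G : Finset α) : Set α)) :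
    phiK (n + 4) 3 * ((UqG M (n + 4) 3 G).card : ℚ) ≤ ∑ S ∈ Yq M (n + 4) 3, wPlus M G S := by
  obtain ⟨K, hKsub, hKind, hKcard⟩ := exists_indep_compl_card G hK
  have hKG : Disjoint K G := by
    rw [Finset.disjoint_left]
    intro x hxK hxG
    have := hKsub hxK
    rw [Finset.mem_sdiff] at this
    exact this.2 hxG
  have hG4 : 4 ≤ G.card := four_le_card_of_oneLine hG h
  -- the family of rank-`3` subsets
  set 𝔅 : Finset (Finset α) := (G.powerset.filter (fun B => 3 ≤ B.card)).erase ℓ with h𝔅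
  have h𝔅mem : ∀ B ∈ 𝔅, B ⊆ G ∧ 3 ≤ B.card ∧ B ≠ ℓ := by
    intro B hB
    rw [h𝔅, Finset.mem_erase, Finset.mem_filter, Finset.mem_powerset] at hB
    exact ⟨hB.2.1, hB.2.2, hB.1⟩
  have h𝔅rank : ∀ B ∈ 𝔅, B ⊆ G ∧ M.eRk (B : Set α) = 3 := by
    intro B hB
    obtain ⟨hBG, hBc, hBℓ⟩ := h𝔅mem B hB
    refine ⟨hBG, ?_⟩
    apply le_antisymm
    · rw [← eRk_eq_three_of_mem_flatsQ' hG]; exact M.eRk_mono (Finset.coe_subset.2 hBG)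
    · -- `B′` contains a `3`-subset other than `ℓ`
      obtain ⟨hℓG, hℓc, hℓr, hone⟩ := h
      obtain ⟨T, hTB, hTc, hTℓ⟩ : ∃ T ⊆ B, T.card = 3 ∧ T ≠ ℓ := by
        by_cases hℓB : ℓ ⊆ B
        · have hlt : 4 ≤ B.card := by
            by_contra hc
            push Not at hc
            exact hBℓ (Finset.eq_of_subset_of_card_le hℓB (by omega)).symm
          obtain ⟨a, haB, haℓ⟩ : ∃ a ∈ B, a ∉ ℓ := by
            by_contra hcon
            push Not at hcon
            have := Finset.card_le_card (show B ⊆ ℓ from hcon)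
            omega
          obtain ⟨P, hPℓ, hPc⟩ := Finset.exists_subset_card_eq (show 2 ≤ ℓ.card by omega)
          refine ⟨insert a P, Finset.insert_subset haB (hPℓ.trans hℓB), ?_, ?_⟩
          · rw [Finset.card_insert_of_notMem (fun h => haℓ (hPℓ h)), hPc]
          · intro h
            exact haℓ (h ▸ Finset.mem_insert_self a P)
        · obtain ⟨T, hTB, hTc⟩ := Finset.exists_subset_card_eq hBc
          by_cases hTℓ : T = ℓ
          · exact absurd (hTℓ ▸ hTB) hℓB
          · exact ⟨T, hTB, hTc, hTℓ⟩
      have hind := hone T (Finset.mem_powersetCard.2 ⟨hTB.trans hBG, hTc⟩) hTℓ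
      rw [← eRk_eq_three_of_indep_card hind hTc]
      exact M.eRk_mono (Finset.coe_subset.2 hTB)
  have h𝔅card : (𝔅.card : ℚ) = demandCount G.card 0 - 1 := by
    have hmem : ℓ ∈ G.powerset.filter (fun B => 3 ≤ B.card) := by
      rw [Finset.mem_filter, Finset.mem_powerset]
      exact ⟨h.1, by rw [h.2.1]⟩
    have hcard : ((G.powerset.filter (fun B => 3 ≤ B.card)).card : ℚ) = demandCount G.card 0 := by
      unfold demandCount
      rw [Finset.card_filter, Nat.cast_sum,
        Finset.sum_powerset_apply_card (fun b => ((if 3 ≤ b then 1 else 0 : ℕ) : ℚ))]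
      apply Finset.sum_congr rfl
      intro b hb
      rw [Finset.mem_range] at hb
      rw [nsmul_eq_mul]
      congr 1
      by_cases h3 : 3 ≤ b
      · rw [if_pos h3, if_pos ⟨h3, by omega⟩]; rfl
      · rw [if_neg h3, if_neg (fun h => h3 h.1)]; rfl
    rw [h𝔅, Finset.card_erase_of_mem hmem, Nat.cast_sub (Finset.card_pos.2 ⟨ℓ, hmem⟩), hcard, Nat.cast_one]
  have hsup := supply_ge_of_family hG h𝔅rank hKsub hKind n (fun B X => oneLineShare M ℓ K B X)
    (fun B hB X hX => by
      obtain ⟨hBG, hBc, hBℓ⟩ := h𝔅mem B hB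
      obtain ⟨hXK, _, _⟩ := mem_witnessFamily hX
      exact oneLineShare_le_wPlus hG h hBG hBc hBℓ (hKind.subset (Finset.coe_subset.2 hXK))
        (Finset.disjoint_of_subset_left hXK hKG) hXK)
  have hdem := card_UqG_le_of_oneLine h (n + 4)
  calc phiK (n + 4) 3 * ((UqG M (n + 4) 3 G).card : ℚ)
      ≤ phiK (n + 4) 3 * (demandCount G.card 0 - 1) := mul_le_mul_of_nonneg_left hdem (phiK_nonneg _ _)
    _ = ∑ B ∈ 𝔅, phiK (n + 4) 3 := by rw [Finset.sum_const, nsmul_eq_mul, h𝔅card, mul_comm]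
    _ ≤ ∑ B ∈ 𝔅, ∑ X ∈ witnessFamily K n, oneLineShare M ℓ K B X := by
        apply Finset.sum_le_sum
        intro B hB
        exact sum_oneLineShare_ge hG h hKsub hKind hn hKcard
    _ ≤ ∑ S ∈ Yq M (n + 4) 3, wPlus M G S := hsup

end NightThree

end PercRepro
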